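import Literature.Barriers.HubbardSuperconductivity.GeneralizedHartreeFockNoPairing
import Literature.LinearAlgebra.Matrix.NearestPositiveSemidefinite
import Mathlib.Algebra.Order.Chebyshev
import HarnessLib

/-!
# A floor on the generalized Hartree–Fock energy of NON-MAGNETIC quasi-free states of the repulsive Hubbard model

Setting and vocabulary of `Literature/Barriers/HubbardSuperconductivity/GeneralizedHartreeFockNoPairing.lean`
(Bach–Lieb–Solovej 1994): a generalized one-particle density matrix `Γ = (γ, α)` over the orbital
basis `|x, σ⟩`, `x ∈ Λ`, `σ ∈ Fin 2`, admissible (`0 ≤ Γ ≤ 1`), and the gHF energy functional of the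
REPULSIVE Hubbard Hamiltonian in the particle–hole symmetric form
`H = Σ t_{xy} c†_{xσ}c_{yσ} + U Σ_x (n_{x↑} − ½)(n_{x↓} − ½)`,
`hubbardGHFEnergy t U Γ = re Tr[(t ⊕ t)γ] + Σ_x U_x {[γ_↑(x) − ½][γ_↓(x) − ½] − |γ_*(x)|² + |α(x↑,x↓)|²}`
(BLS (3a.7) with the sign of `U` reversed, (4a.1)–(4a.2)).

What is proved here (elementary; the printed source of the functional is BLS, the bound is the
textbook "paramagnetic Hartree–Fock energy = band energy + `U n²/4`" statement, written as an
inequality valid for EVERY non-magnetic quasi-free state, paired or not):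

* `re_trace_nsdPart_le_re_trace_mul` — a Ky-Fan-type trace inequality: for Hermitian `t` and
  `0 ≤ γ ≤ 1`, `re Tr[t₋] ≤ re Tr[t γ]` where `t₋ = min(·,0)(t)` is the negative part
  (`NearestPositiveSemidefinite.nsdPart`): the one-body energy of any sub-unit density matrix is at
  least the sum of the negative eigenvalues of `t` (the filled "Fermi sea" of `t`).
* `hubbardGHFEnergy_nonmagnetic_floor` — for constant `U ≥ 0`, every admissible `Γ` that is
  NON-MAGNETIC on every site (`γ_↑(x) = γ_↓(x)` and `γ_*(x) = ⟨x↑|γ|x↓⟩ = 0`, i.e. `⟨S⃗_x⟩ = 0`;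
  the pairing matrix `α` is unrestricted — every singlet BCS/HFB state of any symmetry is allowed)
  with per-spin filling `ν` (`Σ_x γ_↑(x) = |Λ|·ν`, i.e. density `n = 2ν`) satisfies
  `2·re Tr[t₋] + U·|Λ|·(ν − ½)² ≤ hubbardGHFEnergy t U Γ`.
  In the un-shifted convention `U Σ n↑n↓` (add `U(N/2 − |Λ|/4) = U|Λ|(ν − ¼)`) this is the familiar
  floor `E ≥ −K(Λ) + U|Λ| n²/4`, `K(Λ) = −2 Tr[t₋]` the free (both-spin) Fermi-sea energy.

Proof: kinetic part by the trace inequality applied to each spin block of `γ` (a principal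
submatrix of `0 ≤ Γ ≤ 1`); interaction part: with `γ_↑ = γ_↓ =: m_x` and `γ_* = 0` each site
contributes `U{(m_x − ½)² + |α|²} ≥ U(m_x − ½)²`, and `Σ_x (m_x − ½)² ≥ |Λ|(ν − ½)²` (Chebyshev /
Jensen, `sq_sum_le_card_mul_sum_sq`). Nothing here is a barrier or a named fact; no definition is
introduced (spin blocks are written as `submatrix`).
-/

namespace Literature.MathematicalPhysics.QuantumLattice

open Matrix Literature.Barriers.HubbardSuperconductivity
  Literature.LinearAlgebra.Matrix.NearestPositiveSemidefinite GHFState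
open scoped ComplexOrder

universe u

section KyFan

variable {Λ : Type*} [Fintype Λ] [DecidableEq Λ]

/-- **Ky-Fan-type floor on a one-body energy.** For a Hermitian `t` and a matrix `γ` with
`0 ≤ γ ≤ 1` (both `γ` and `1 − γ` positive semidefinite), `re Tr[t₋] ≤ re Tr[t γ]`, where
`t₋ = nsdPart t` is the negative part of `t`: the one-body energy `Tr[tγ]` is minimised by filling
the negative-energy eigenmodes ("the variational energy ... is bounded below by the ground state
energy of the one-body operator", the bathtub principle). [cite: LiebLoss2001, Thm 1.14 (bathtub principle)] -/
theorem re_trace_nsdPart_le_re_trace_mul {t γ : Matrix Λ Λ ℂ} (ht : t.IsHermitian)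
    (hγ : γ.PosSemidef) (hγ1 : (1 - γ).PosSemidef) :
    (nsdPart t).trace.re ≤ (t * γ).trace.re := by
  have hsplit : t * γ = psdPart t * γ + nsdPart t * γ := by
    rw [← Matrix.add_mul, psdPart_add_nsdPart ht]
  have h1 : 0 ≤ (psdPart t * γ).trace.re := by
    have := re_trace_mul_nonneg (posSemidef_psdPart t) hγ
    simpa using this
  have h2 : 0 ≤ ((-nsdPart t) * (1 - γ)).trace.re := by
    have := re_trace_mul_nonneg (posSemidef_neg_nsdPart t) hγ1
    simpa using this
  have h3 : ((-nsdPart t) * (1 - γ)).trace = -(nsdPart t).trace + (nsdPart t * γ).trace := by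
    rw [Matrix.neg_mul, Matrix.mul_sub, Matrix.mul_one, trace_neg, trace_sub]
    ring
  rw [h3] at h2
  simp only [Complex.add_re, Complex.neg_re] at h2
  rw [hsplit, trace_add, Complex.add_re]
  linarith

end KyFan

section Floor

variable {Λ : Type u} [Fintype Λ] [DecidableEq Λ]

omit [Fintype Λ] in
/-- The `σ`-spin block of `γ` is a principal submatrix of the 1-pdm `Γ`; for admissible `Γ`
it satisfies `0 ≤ γ_σ ≤ 1`. [cite: BachLiebSolovej1994, (2b.3) (0 ≤ Γ ≤ 1)] -/
theorem spinBlock_posSemidef {Γ : GHFState (Λ × Fin 2)} (hΓ : Γ.IsAdmissible) (σ : Fin 2) :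
    (Γ.γ.submatrix (fun x : Λ => (x, σ)) (fun x : Λ => (x, σ))).PosSemidef ∧
      (1 - Γ.γ.submatrix (fun x : Λ => (x, σ)) (fun x : Λ => (x, σ))).PosSemidef := by
  obtain ⟨-, -, hpos, hle⟩ := hΓ
  have e1 : Γ.γ.submatrix (fun x : Λ => (x, σ)) (fun x : Λ => (x, σ)) =
      Γ.onePDM.submatrix (fun x : Λ => Sum.inl (x, σ)) (fun x : Λ => Sum.inl (x, σ)) := by
    ext x y
    simp [onePDM]
  have e2 : 1 - Γ.γ.submatrix (fun x : Λ => (x, σ)) (fun x : Λ => (x, σ)) =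
      (1 - Γ.onePDM).submatrix (fun x : Λ => Sum.inl (x, σ)) (fun x : Λ => Sum.inl (x, σ)) := by
    ext x y
    by_cases h : x = y
    · subst h; simp [onePDM, one_apply]
    · simp [onePDM, one_apply, h]
  refine ⟨?_, ?_⟩
  · rw [e1]; exact hpos.submatrix _
  · rw [e2]; exact hle.submatrix _

omit [DecidableEq Λ] in
/-- The kinetic term of `hubbardGHFEnergy` is the sum over spins of `Tr[t γ_σ]` with `γ_σ` the
spin blocks. [cite: BachLiebSolovej1994, (3a.7)] -/
theorem hubbard_kinetic_eq_sum_trace (t : Matrix Λ Λ ℂ) (Γ : GHFState (Λ × Fin 2)) :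
    (∑ σ : Fin 2, ∑ x : Λ, ∑ y : Λ, t x y * Γ.γ (y, σ) (x, σ)) =
      ∑ σ : Fin 2, (t * Γ.γ.submatrix (fun x : Λ => (x, σ)) (fun x : Λ => (x, σ))).trace := by
  refine Finset.sum_congr rfl fun σ _ => ?_
  simp only [Matrix.trace, Matrix.diag, Matrix.mul_apply, Matrix.submatrix_apply]

omit [DecidableEq Λ] in
/-- **Chebyshev/Jensen step**: if `Σ_x m_x = |Λ|·ν` then `|Λ|·(ν − ½)² ≤ Σ_x (m_x − ½)²`.
[cite: LiebLoss2001, Thm 2.2 (Jensen's inequality)] -/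
theorem card_mul_sq_le_sum_sq_of_sum_eq {m : Λ → ℝ} {ν : ℝ}
    (hsum : ∑ x, m x = Fintype.card Λ * ν) :
    (Fintype.card Λ : ℝ) * (ν - 1 / 2) ^ 2 ≤ ∑ x, (m x - 1 / 2) ^ 2 := by
  have hcheb := sq_sum_le_card_mul_sum_sq (s := (Finset.univ : Finset Λ)) (f := fun x => m x - 1 / 2)
  have hs : ∑ x, (m x - 1 / 2) = Fintype.card Λ * (ν - 1 / 2) := by
    rw [Finset.sum_sub_distrib, hsum, Finset.sum_const, Finset.card_univ, nsmul_eq_mul]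
    ring
  rw [hs, Finset.card_univ] at hcheb
  rcases Nat.eq_zero_or_pos (Fintype.card Λ) with h0 | hpos
  · simp [h0]
    exact Finset.sum_nonneg fun x _ => sq_nonneg _
  · have hc : (0 : ℝ) < Fintype.card Λ := by exact_mod_cast hpos
    nlinarith [hcheb, hc, sq_nonneg (ν - 1 / 2)]

/-- **Floor on the gHF energy of non-magnetic quasi-free states (repulsive Hubbard model).**
Let `U ≥ 0` be constant, `t` Hermitian, and `Γ = (γ, α)` admissible and NON-MAGNETIC at every site,
`γ_↑(x) = γ_↓(x)` and `γ_*(x) = ⟨x↑|γ|x↓⟩ = 0` (no local spin polarisation; the pairing matrix `α`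
is arbitrary, so every singlet BCS / HFB state is included), with per-spin filling `ν`:
`Σ_x re γ_↑(x) = |Λ|·ν`. Then
`2·re Tr[t₋] + U·|Λ|·(ν − ½)² ≤ hubbardGHFEnergy t U Γ`
— the paramagnetic Hartree–Fock floor "band minimum plus `U n²/4`" (in BLS's particle–hole
symmetric normalisation (4a.1); `t₋ = nsdPart t`). Derived here from the printed functional.
[cite: BachLiebSolovej1994, (3a.7), (4a.1)–(4a.2) and Theorem 2.8 (2c.13)] -/
theorem hubbardGHFEnergy_nonmagnetic_floor (t : Matrix Λ Λ ℂ) (ht : t.IsHermitian) {U₀ : ℝ}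
    (hU : 0 ≤ U₀) {Γ : GHFState (Λ × Fin 2)} (hΓ : Γ.IsAdmissible)
    (hpara : ∀ x : Λ, Γ.γ (x, 0) (x, 0) = Γ.γ (x, 1) (x, 1) ∧ Γ.γ (x, 0) (x, 1) = 0) {ν : ℝ}
    (hfill : ∑ x : Λ, (Γ.γ (x, 0) (x, 0)).re = Fintype.card Λ * ν) :
    2 * (nsdPart t).trace.re + U₀ * Fintype.card Λ * (ν - 1 / 2) ^ 2 ≤
      hubbardGHFEnergy t (fun _ => U₀) Γ := by
  unfold hubbardGHFEnergy
  -- kinetic part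
  have hkin : 2 * (nsdPart t).trace.re ≤
      (∑ σ : Fin 2, ∑ x : Λ, ∑ y : Λ, t x y * Γ.γ (y, σ) (x, σ)).re := by
    rw [hubbard_kinetic_eq_sum_trace, Complex.re_sum]
    have hσ : ∀ σ : Fin 2, (nsdPart t).trace.re ≤
        (t * Γ.γ.submatrix (fun x : Λ => (x, σ)) (fun x : Λ => (x, σ))).trace.re := fun σ =>
      re_trace_nsdPart_le_re_trace_mul ht (spinBlock_posSemidef hΓ σ).1 (spinBlock_posSemidef hΓ σ).2
    have := Finset.sum_le_sum fun σ (_ : σ ∈ (Finset.univ : Finset (Fin 2))) => hσ σ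
    simpa [Finset.sum_const, two_mul] using this
  -- interaction part
  have hint : U₀ * Fintype.card Λ * (ν - 1 / 2) ^ 2 ≤
      ∑ x : Λ, U₀ * (((Γ.γ (x, 0) (x, 0)).re - 1 / 2) * ((Γ.γ (x, 1) (x, 1)).re - 1 / 2)
        - ‖Γ.γ (x, 0) (x, 1)‖ ^ 2 + ‖Γ.α (x, 0) (x, 1)‖ ^ 2) := by
    have hx : ∀ x : Λ, U₀ * ((Γ.γ (x, 0) (x, 0)).re - 1 / 2) ^ 2 ≤
        U₀ * (((Γ.γ (x, 0) (x, 0)).re - 1 / 2) * ((Γ.γ (x, 1) (x, 1)).re - 1 / 2)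
          - ‖Γ.γ (x, 0) (x, 1)‖ ^ 2 + ‖Γ.α (x, 0) (x, 1)‖ ^ 2) := by
      intro x
      obtain ⟨h01, hstar⟩ := hpara x
      rw [← h01, hstar, norm_zero]
      have : 0 ≤ ‖Γ.α (x, 0) (x, 1)‖ ^ 2 := sq_nonneg _
      nlinarith
    have hcheb := card_mul_sq_le_sum_sq_of_sum_eq hfill
    calc U₀ * Fintype.card Λ * (ν - 1 / 2) ^ 2
        = U₀ * ((Fintype.card Λ : ℝ) * (ν - 1 / 2) ^ 2) := by ring
      _ ≤ U₀ * ∑ x : Λ, ((Γ.γ (x, 0) (x, 0)).re - 1 / 2) ^ 2 := mul_le_mul_of_nonneg_left hcheb hU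
      _ = ∑ x : Λ, U₀ * ((Γ.γ (x, 0) (x, 0)).re - 1 / 2) ^ 2 := by rw [Finset.mul_sum]
      _ ≤ _ := Finset.sum_le_sum fun x _ => hx x
  linarith

end Floor

/-! ### The MAGNETIC floor: arbitrary quasi-free states with a local-moment budget (appended 2026-08-27 by hubbard-tc-mod-3 g4) -/

section MomentFloor

variable {Λ : Type u} [Fintype Λ] [DecidableEq Λ]

/-- **Floor on the gHF energy of an ARBITRARY quasi-free state in terms of its ordered moments (repulsive
Hubbard model).** Let `U ≥ 0` be constant, `t` Hermitian, `Γ = (γ, α)` admissible (no non-magnetic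
assumption: spin polarisation `γ_↑(x) ≠ γ_↓(x)`, spin-flip `γ_*(x) = ⟨x↑|γ|x↓⟩ ≠ 0` and pairing `α` all allowed —
every Slater determinant and every BdG/HFB state: Néel-HF, spirals, HF stripes / SDW+CDW textures, singlet or
triplet BCS on top of them), with total filling `Σ_x (re γ_↑(x) + re γ_↓(x)) = |Λ|·2ν`. Then
`2·re Tr[t₋] + U·(|Λ|·(ν − ½)² − Σ_x [((re γ_↑(x) − re γ_↓(x))/2)² + ‖γ_*(x)‖²]) ≤ hubbardGHFEnergy t U Γ`.
Per site, Wick gives `(γ_↑ − ½)(γ_↓ − ½) − |γ_*|² + |α|² ≥ ((n_x − 1)/2)² − |⟨S⃗_x⟩|²` with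
`|⟨S⃗_x⟩|² = ((γ_↑ − γ_↓)/2)² + |γ_*|²` (`(m^z)² + (m^x)² + (m^y)²`), and Jensen bounds `Σ_x ((n_x − 1)/2)²` below by
`|Λ|(ν − ½)²` — so a mean-field competitor can undercut the paramagnetic floor
(`hubbardGHFEnergy_nonmagnetic_floor`, the case of zero moments) by at most `U·Σ_x |⟨S⃗_x⟩|²`: a LOW gHF energy
REQUIRES large ordered local moments. With a certified ground-state double-occupancy ceiling this is the
«minimum ordered moment for mean-field competitors» reading of the hubbard-tc G3 back-end. Derived from the printed
functional; no definition introduced. [cite: BachLiebSolovej1994, (3a.7), (4a.1)–(4a.2) and Theorem 2.8 (2c.13)] -/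
theorem hubbardGHFEnergy_moment_floor (t : Matrix Λ Λ ℂ) (ht : t.IsHermitian) {U₀ : ℝ}
    (hU : 0 ≤ U₀) {Γ : GHFState (Λ × Fin 2)} (hΓ : Γ.IsAdmissible) {ν : ℝ}
    (hfill : ∑ x : Λ, ((Γ.γ (x, 0) (x, 0)).re + (Γ.γ (x, 1) (x, 1)).re) = Fintype.card Λ * (2 * ν)) :
    2 * (nsdPart t).trace.re + U₀ * (Fintype.card Λ * (ν - 1 / 2) ^ 2
      - ∑ x : Λ, ((((Γ.γ (x, 0) (x, 0)).re - (Γ.γ (x, 1) (x, 1)).re) / 2) ^ 2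
          + ‖Γ.γ (x, 0) (x, 1)‖ ^ 2)) ≤
      hubbardGHFEnergy t (fun _ => U₀) Γ := by
  unfold hubbardGHFEnergy
  -- kinetic part (as in the non-magnetic floor)
  have hkin : 2 * (nsdPart t).trace.re ≤
      (∑ σ : Fin 2, ∑ x : Λ, ∑ y : Λ, t x y * Γ.γ (y, σ) (x, σ)).re := by
    rw [hubbard_kinetic_eq_sum_trace, Complex.re_sum]
    have hσ : ∀ σ : Fin 2, (nsdPart t).trace.re ≤
        (t * Γ.γ.submatrix (fun x : Λ => (x, σ)) (fun x : Λ => (x, σ))).trace.re := fun σ =>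
      re_trace_nsdPart_le_re_trace_mul ht (spinBlock_posSemidef hΓ σ).1 (spinBlock_posSemidef hΓ σ).2
    have := Finset.sum_le_sum fun σ (_ : σ ∈ (Finset.univ : Finset (Fin 2))) => hσ σ
    simpa [Finset.sum_const, two_mul] using this
  -- interaction part: Wick per site, then Jensen on the local densities
  have hx : ∀ x : Λ,
      U₀ * (((((Γ.γ (x, 0) (x, 0)).re + (Γ.γ (x, 1) (x, 1)).re) / 2 - 1 / 2) ^ 2)
        - ((((Γ.γ (x, 0) (x, 0)).re - (Γ.γ (x, 1) (x, 1)).re) / 2) ^ 2 + ‖Γ.γ (x, 0) (x, 1)‖ ^ 2)) ≤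
      U₀ * (((Γ.γ (x, 0) (x, 0)).re - 1 / 2) * ((Γ.γ (x, 1) (x, 1)).re - 1 / 2)
        - ‖Γ.γ (x, 0) (x, 1)‖ ^ 2 + ‖Γ.α (x, 0) (x, 1)‖ ^ 2) := by
    intro x
    have e : U₀ * (((Γ.γ (x, 0) (x, 0)).re - 1 / 2) * ((Γ.γ (x, 1) (x, 1)).re - 1 / 2)
        - ‖Γ.γ (x, 0) (x, 1)‖ ^ 2 + ‖Γ.α (x, 0) (x, 1)‖ ^ 2)
        - U₀ * (((((Γ.γ (x, 0) (x, 0)).re + (Γ.γ (x, 1) (x, 1)).re) / 2 - 1 / 2) ^ 2)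
          - ((((Γ.γ (x, 0) (x, 0)).re - (Γ.γ (x, 1) (x, 1)).re) / 2) ^ 2 + ‖Γ.γ (x, 0) (x, 1)‖ ^ 2))
        = U₀ * ‖Γ.α (x, 0) (x, 1)‖ ^ 2 := by ring
    have hα : 0 ≤ U₀ * ‖Γ.α (x, 0) (x, 1)‖ ^ 2 := mul_nonneg hU (sq_nonneg _)
    linarith
  have hfill' : ∑ x : Λ, ((Γ.γ (x, 0) (x, 0)).re + (Γ.γ (x, 1) (x, 1)).re) / 2 = Fintype.card Λ * ν := by
    rw [← Finset.sum_div, hfill]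
    ring
  have hcheb := card_mul_sq_le_sum_sq_of_sum_eq hfill'
  have h1 : U₀ * (Fintype.card Λ * (ν - 1 / 2) ^ 2) ≤
      U₀ * ∑ x : Λ, (((Γ.γ (x, 0) (x, 0)).re + (Γ.γ (x, 1) (x, 1)).re) / 2 - 1 / 2) ^ 2 :=
    mul_le_mul_of_nonneg_left hcheb hU
  have h2 := Finset.sum_le_sum fun x (_ : x ∈ (Finset.univ : Finset Λ)) => hx x
  have h3 : ∑ x : Λ, U₀ * (((((Γ.γ (x, 0) (x, 0)).re + (Γ.γ (x, 1) (x, 1)).re) / 2 - 1 / 2) ^ 2)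
        - ((((Γ.γ (x, 0) (x, 0)).re - (Γ.γ (x, 1) (x, 1)).re) / 2) ^ 2 + ‖Γ.γ (x, 0) (x, 1)‖ ^ 2)) =
      U₀ * ∑ x : Λ, (((Γ.γ (x, 0) (x, 0)).re + (Γ.γ (x, 1) (x, 1)).re) / 2 - 1 / 2) ^ 2
        - U₀ * ∑ x : Λ, ((((Γ.γ (x, 0) (x, 0)).re - (Γ.γ (x, 1) (x, 1)).re) / 2) ^ 2 + ‖Γ.γ (x, 0) (x, 1)‖ ^ 2) := by
    rw [Finset.mul_sum, Finset.mul_sum, ← Finset.sum_sub_distrib]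
    refine Finset.sum_congr rfl fun x _ => ?_
    ring
  have hint : U₀ * (Fintype.card Λ * (ν - 1 / 2) ^ 2
      - ∑ x : Λ, ((((Γ.γ (x, 0) (x, 0)).re - (Γ.γ (x, 1) (x, 1)).re) / 2) ^ 2 + ‖Γ.γ (x, 0) (x, 1)‖ ^ 2)) ≤
      ∑ x : Λ, U₀ * (((Γ.γ (x, 0) (x, 0)).re - 1 / 2) * ((Γ.γ (x, 1) (x, 1)).re - 1 / 2)
        - ‖Γ.γ (x, 0) (x, 1)‖ ^ 2 + ‖Γ.α (x, 0) (x, 1)‖ ^ 2) := by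
    have e : U₀ * (Fintype.card Λ * (ν - 1 / 2) ^ 2
        - ∑ x : Λ, ((((Γ.γ (x, 0) (x, 0)).re - (Γ.γ (x, 1) (x, 1)).re) / 2) ^ 2 + ‖Γ.γ (x, 0) (x, 1)‖ ^ 2)) =
        U₀ * (Fintype.card Λ * (ν - 1 / 2) ^ 2)
        - U₀ * ∑ x : Λ, ((((Γ.γ (x, 0) (x, 0)).re - (Γ.γ (x, 1) (x, 1)).re) / 2) ^ 2 + ‖Γ.γ (x, 0) (x, 1)‖ ^ 2) := by
      ring
    rw [e]
    linarith
  linarith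

omit [DecidableEq Λ] in
/-- **Corollary — double-occupancy form.** For every admissible `Γ` with total filling `|Λ|·2ν`, the gHF on-site
interaction sum obeys `Σ_x [(γ_↑ − ½)(γ_↓ − ½) − |γ_*|² + |α|²] ≥ |Λ|(ν − ½)² − Σ_x |⟨S⃗_x⟩|²` (the `U`-coefficient of
`hubbardGHFEnergy_moment_floor`, stated on its own: in the un-shifted convention the quasi-free double occupancy is
`≥ |Λ|ν² − Σ_x |⟨S⃗_x⟩|²`, i.e. per site `docc ≥ (n/2)² − μ²` with `μ²` the mean-square ordered moment).
[cite: BachLiebSolovej1994, (3a.7), (2c.36)] -/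
theorem ghf_onSite_sum_ge_filling_sq_sub_moments {Γ : GHFState (Λ × Fin 2)} {ν : ℝ}
    (hfill : ∑ x : Λ, ((Γ.γ (x, 0) (x, 0)).re + (Γ.γ (x, 1) (x, 1)).re) = Fintype.card Λ * (2 * ν)) :
    Fintype.card Λ * (ν - 1 / 2) ^ 2
      - ∑ x : Λ, ((((Γ.γ (x, 0) (x, 0)).re - (Γ.γ (x, 1) (x, 1)).re) / 2) ^ 2 + ‖Γ.γ (x, 0) (x, 1)‖ ^ 2) ≤
      ∑ x : Λ, (((Γ.γ (x, 0) (x, 0)).re - 1 / 2) * ((Γ.γ (x, 1) (x, 1)).re - 1 / 2)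
        - ‖Γ.γ (x, 0) (x, 1)‖ ^ 2 + ‖Γ.α (x, 0) (x, 1)‖ ^ 2) := by
  have hx : ∀ x : Λ,
      (((((Γ.γ (x, 0) (x, 0)).re + (Γ.γ (x, 1) (x, 1)).re) / 2 - 1 / 2) ^ 2)
        - ((((Γ.γ (x, 0) (x, 0)).re - (Γ.γ (x, 1) (x, 1)).re) / 2) ^ 2 + ‖Γ.γ (x, 0) (x, 1)‖ ^ 2)) ≤
      (((Γ.γ (x, 0) (x, 0)).re - 1 / 2) * ((Γ.γ (x, 1) (x, 1)).re - 1 / 2)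
        - ‖Γ.γ (x, 0) (x, 1)‖ ^ 2 + ‖Γ.α (x, 0) (x, 1)‖ ^ 2) := by
    intro x
    nlinarith [sq_nonneg ‖Γ.α (x, 0) (x, 1)‖]
  have hfill' : ∑ x : Λ, ((Γ.γ (x, 0) (x, 0)).re + (Γ.γ (x, 1) (x, 1)).re) / 2 = Fintype.card Λ * ν := by
    rw [← Finset.sum_div, hfill]
    ring
  have hcheb := card_mul_sq_le_sum_sq_of_sum_eq hfill'
  have h2 := Finset.sum_le_sum fun x (_ : x ∈ (Finset.univ : Finset Λ)) => hx x
  rw [Finset.sum_sub_distrib] at h2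
  linarith

omit [DecidableEq Λ] in
/-- **Corollary — minimum ordered moment from a double-occupancy budget (un-shifted convention).** For every
`Γ = (γ, α)` with total filling `Σ_x (re γ_↑(x) + re γ_↓(x)) = |Λ|·2ν` whose quasi-free (Wick) double occupancy
`Σ_x ⟨n_{x↑}n_{x↓}⟩_Γ = Σ_x [re γ_↑(x)·re γ_↓(x) − |γ_*(x)|² + |α(x↑,x↓)|²]` is at most `|Λ|·d`, the ordered local moments obey
`|Λ|·(ν² − d) ≤ Σ_x |⟨S⃗_x⟩|²`, `|⟨S⃗_x⟩|² = ((re γ_↑(x) − re γ_↓(x))/2)² + |γ_*(x)|²` — i.e. the mean-square moment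
`μ² := |Λ|⁻¹ Σ_x |⟨S⃗_x⟩|²` of any quasi-free state (Slater determinant or BdG/HFB: Néel-HF, spirals, HF stripes / SDW+CDW
textures, singlet or triplet BCS on top of them) with docc per site `≤ d` is `≥ ν² − d = (n/2)² − d`. This is
`ghf_onSite_sum_ge_filling_sq_sub_moments` rewritten from BLS's particle–hole-shifted on-site term
`(γ_↑ − ½)(γ_↓ − ½) − |γ_*|² + |α|² = ⟨n_↑n_↓⟩ − n_x/2 + ¼` by summing `n_x` to `|Λ|·2ν`; no admissibility is needed (pure
Wick algebra + Jensen). With a certified ground-state docc CEILING `d` at density `2ν` it reads: every mean-field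
competitor not already excluded by that ceiling carries rms ordered moment `≥ √((n/2)² − d)`.
[cite: BachLiebSolovej1994, (3a.7), (2c.36)] -/
theorem ghf_card_mul_sq_sub_le_sum_sq_moments_of_docc_le {Γ : GHFState (Λ × Fin 2)} {ν d : ℝ}
    (hfill : ∑ x : Λ, ((Γ.γ (x, 0) (x, 0)).re + (Γ.γ (x, 1) (x, 1)).re) = Fintype.card Λ * (2 * ν))
    (hdocc : ∑ x : Λ, ((Γ.γ (x, 0) (x, 0)).re * (Γ.γ (x, 1) (x, 1)).re
        - ‖Γ.γ (x, 0) (x, 1)‖ ^ 2 + ‖Γ.α (x, 0) (x, 1)‖ ^ 2) ≤ Fintype.card Λ * d) :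
    Fintype.card Λ * (ν ^ 2 - d) ≤
      ∑ x : Λ, ((((Γ.γ (x, 0) (x, 0)).re - (Γ.γ (x, 1) (x, 1)).re) / 2) ^ 2 + ‖Γ.γ (x, 0) (x, 1)‖ ^ 2) := by
  have h := ghf_onSite_sum_ge_filling_sq_sub_moments hfill
  -- the shifted on-site sum equals the un-shifted one minus `(1/2)·Σ n_x` plus `|Λ|/4`
  have e : ∑ x : Λ, (((Γ.γ (x, 0) (x, 0)).re - 1 / 2) * ((Γ.γ (x, 1) (x, 1)).re - 1 / 2)
        - ‖Γ.γ (x, 0) (x, 1)‖ ^ 2 + ‖Γ.α (x, 0) (x, 1)‖ ^ 2) =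
      ∑ x : Λ, ((Γ.γ (x, 0) (x, 0)).re * (Γ.γ (x, 1) (x, 1)).re
        - ‖Γ.γ (x, 0) (x, 1)‖ ^ 2 + ‖Γ.α (x, 0) (x, 1)‖ ^ 2)
      - (1 / 2) * ∑ x : Λ, ((Γ.γ (x, 0) (x, 0)).re + (Γ.γ (x, 1) (x, 1)).re)
      + ∑ _x : Λ, (1 / 4 : ℝ) := by
    rw [Finset.mul_sum, ← Finset.sum_sub_distrib, ← Finset.sum_add_distrib]
    exact Finset.sum_congr rfl fun x _ => by ring
  rw [hfill, Finset.sum_const, Finset.card_univ, nsmul_eq_mul] at e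
  rw [e] at h
  nlinarith [h, hdocc]

omit [DecidableEq Λ] in
/-- **Mean-square form** of `ghf_card_mul_sq_sub_le_sum_sq_moments_of_docc_le`: on a non-empty lattice, filling `2ν` and
quasi-free docc per site `≤ d` force `ν² − d ≤ |Λ|⁻¹ Σ_x |⟨S⃗_x⟩|²` (the mean-square ordered moment).
[cite: BachLiebSolovej1994, (3a.7), (2c.36)] -/
theorem ghf_sq_sub_le_meanSq_moment_of_docc_le [Nonempty Λ] {Γ : GHFState (Λ × Fin 2)} {ν d : ℝ}
    (hfill : ∑ x : Λ, ((Γ.γ (x, 0) (x, 0)).re + (Γ.γ (x, 1) (x, 1)).re) = Fintype.card Λ * (2 * ν))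
    (hdocc : ∑ x : Λ, ((Γ.γ (x, 0) (x, 0)).re * (Γ.γ (x, 1) (x, 1)).re
        - ‖Γ.γ (x, 0) (x, 1)‖ ^ 2 + ‖Γ.α (x, 0) (x, 1)‖ ^ 2) ≤ Fintype.card Λ * d) :
    ν ^ 2 - d ≤
      (∑ x : Λ, ((((Γ.γ (x, 0) (x, 0)).re - (Γ.γ (x, 1) (x, 1)).re) / 2) ^ 2 + ‖Γ.γ (x, 0) (x, 1)‖ ^ 2)) /
        Fintype.card Λ := by
  have hc : (0 : ℝ) < Fintype.card Λ := by exact_mod_cast Fintype.card_pos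
  rw [le_div_iff₀ hc, mul_comm]
  exact ghf_card_mul_sq_sub_le_sum_sq_moments_of_docc_le hfill hdocc

end MomentFloor

end Literature.MathematicalPhysics.QuantumLattice
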